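import Summits.Ventures.Crystal3D.Theorems.StickyWulffConstantTextureLiminfTexShadowPiecedDefs
import Summits.Ventures.Crystal3D.Theorems.StickyWulffConstantGenericWallFloorBarlowCoreAvoid
import HarnessLib

/-!
# TexShadow (V) PIECED PLATES, P2: «locally a Barlow stacking», pieced SEALING (S′) and pieced FRAME IDENTIFICATION (F′)
# (lane T, crux `TextureLiminfV5`, stmt-Ventures-23912; cf-p1 (clxi)/(clxxxv)/(cxcv): P2 working definition ACCEPTED 10:07:58Z; design HOME/wall-p2-g12/PIECED-DESIGN-0.md)

HONEST FRAMING. Venture `Summits/Ventures/Crystal3D` (cell `crystal3d-full`), route `route-Ventures-StickyWulffConstant`, helper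
`--supports` the law-v5 crux `TextureLiminfV5` (stmt-Ventures-23912).  One definition + elementary set/metric arguments on top of the landed
one-piece lemmas (`stacking_exists_near_ge`, `barlow_frame_eq_or_eq_twin`); standard axioms; no wall law is asserted; rung F-C1 not moved.

THE POINT.  The one-piece K1a proof uses «plate = ONE stacking on the whole clamp» in exactly two non-local places: SEALING (no foreign ball inside
the clamp core: `stacking_sealing_below/_above`) and FRAME IDENTIFICATION (a ball deep in the plate with three independent exact `F`-slots has
`F·Λ₀ ∈ {L·Λ₀, basal twin}`: `barlow_frame_of_exact_neighbours_low/_high`).  Both only ever look inside the unit ball around the point.  So for a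
PIECED plate `S = piecedStacking L σ k s D` (P1) they survive at every point `q` where `S` is **locally a Barlow stacking of the same lattice**:
* **`LocallyBarlowAt S L q`** := `∃ N G t τ, IsHaggSeq τ ∧ closedBall q 1 ⊆ N ∧ G·Λ₀ = L·Λ₀ ∧ S ∩ N = stacking G t τ ∩ N` — true in the interior of
  a territory (`locallyBarlowAt_piecedStacking_of_closedBall_subset`: `G = L`, `t = s a`, `τ = σ`) and, BY DEFINITION OF A CLEAN SEAM, across an inclined
  Shockley seam inside fcc runs (`G` = the inclined frame of the same lattice, `τ` the faulted inclined word); false only in MISFIT COLLARS;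
* **`exists_near_ge_of_locallyBarlowAt`** — the upper-neighbour lemma for `S` at such `q` (`q ∉ S ⇒ ∃ v ∈ S, dist q v < 1, ⟪q,ν⟫ ≤ ⟪v,ν⟫`);
* **`pieced_sealing_below` / `pieced_sealing_above`** — (S′): the clamp sealing lemmas for pieced plates, verbatim `stacking_sealing_*` plus the
  hypothesis `LocallyBarlowAt S L q` at the tested point;
* **`pieced_frame_of_exact_neighbours_low` / `_high`** — (F′): a ball `y` deep in a clamped pieced plate, regular together with its unit
  neighbourhood (`∀ q ∈ X, dist q y ≤ 1 → LocallyBarlowAt S L q`), with three independent exact `F`-slots in `X`, has `F·Λ₀ = L·Λ₀` or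
  `F·Λ₀ = (twinFrame G (G e₃))·Λ₀` for a frame `G` of the same lattice (`G·Λ₀ = L·Λ₀`): the BASAL twin in a territory's interior, an INCLINED twin at a
  clean seam — whence clause (i′) of the pieced certificate: «no chain frame carries `L₂·Λ₀` or any `{111}`-twin of it».
WHAT THIS IS NOT: no walker statement, no certificate; the plate-data predicate (which points are regular, collar lengths) is P3's; F-C1 not moved.
-/

noncomputable section

open scoped BigOperators InnerProductSpace ENNReal
open MeasureTheory Filter

namespace Summit.Ventures.Crystal3D.Cruxes.TextureLiminf.TexShadow

open Summit.Ventures.Crystal3D Summit.Ventures.Crystal3D.Theorems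
open Literature.MathematicalPhysics.StatisticalMechanics (IsHaggSeq fccStacking barlowStacking basalMirror)

/-! ## Locally a Barlow stacking of the same lattice -/

/-- **`S` is locally (on the closed unit ball about `q`) a Barlow stacking of the same lattice as `L`**: on some `N ⊇ closedBall q 1`, `S` coincides
with a moved Hägg stacking `stacking G t τ` whose frame `G` carries `L`'s lattice (`G·Λ₀ = L·Λ₀`). -/
def LocallyBarlowAt (S : Set E3) (L : E3 ≃ₗᵢ[ℝ] E3) (q : E3) : Prop :=
  ∃ (N : Set E3) (G : E3 ≃ₗᵢ[ℝ] E3) (t : E3) (τ : ℤ → ℤ), IsHaggSeq τ ∧ Metric.closedBall q 1 ⊆ N ∧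
    G '' fccStacking 1 (Real.sqrt (2 / 3)) = L '' fccStacking 1 (Real.sqrt (2 / 3)) ∧ S ∩ N = stacking G t τ ∩ N

/-- A plain stacking is locally Barlow everywhere. -/
theorem locallyBarlowAt_stacking {σ : ℤ → ℤ} (hσ : IsHaggSeq σ) (L : E3 ≃ₗᵢ[ℝ] E3) (s q : E3) :
    LocallyBarlowAt (stacking L s σ) L q :=
  ⟨Set.univ, L, s, σ, hσ, Set.subset_univ _, rfl, rfl⟩

/-- On a territory, the pieced stacking is that territory's piece (territories pairwise disjoint). -/
theorem piecedStacking_inter_territory (L : E3 ≃ₗᵢ[ℝ] E3) (σ : ℤ → ℤ) (k : ℕ) (s : Fin k → E3) (D : Fin k → Set E3)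
    (hD : ∀ a b : Fin k, a ≠ b → Disjoint (D a) (D b)) (a : Fin k) :
    piecedStacking L σ k s D ∩ D a = stacking L (s a) σ ∩ D a := by
  ext p
  simp only [Set.mem_inter_iff, mem_piecedStacking_iff]
  constructor
  · rintro ⟨⟨b, hpb, hpDb⟩, hpDa⟩
    by_cases hba : b = a
    · subst hba; exact ⟨hpb, hpDa⟩
    · exact absurd hpDa (Set.disjoint_left.1 (hD b a hba) hpDb)
  · rintro ⟨hp, hpD⟩
    exact ⟨⟨a, hp, hpD⟩, hpD⟩

/-- **Interior points are regular**: if the closed unit ball about `q` lies in ONE territory, the pieced stacking is locally Barlow at `q`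
(`G = L`, `t = s a`, `τ = σ`). -/
theorem locallyBarlowAt_piecedStacking_of_closedBall_subset {σ : ℤ → ℤ} (hσ : IsHaggSeq σ) (L : E3 ≃ₗᵢ[ℝ] E3) (k : ℕ) (s : Fin k → E3)
    (D : Fin k → Set E3) (hD : ∀ a b : Fin k, a ≠ b → Disjoint (D a) (D b)) {q : E3} {a : Fin k} (hq : Metric.closedBall q 1 ⊆ D a) :
    LocallyBarlowAt (piecedStacking L σ k s D) L q :=
  ⟨D a, L, s a, σ, hσ, hq, rfl, piecedStacking_inter_territory L σ k s D hD a⟩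

/-! ## The upper-neighbour lemma at regular points -/

/-- **Upper-neighbour lemma for a locally-Barlow set**: if `S` is locally Barlow at `q ∉ S` then for every `ν` some `v ∈ S` has `dist q v < 1` and
`⟪q, ν⟫ ≤ ⟪v, ν⟫` (`stacking_exists_near_ge` for the local stacking; the site found lies in the unit ball, hence in `N`, hence in `S`). -/
theorem exists_near_ge_of_locallyBarlowAt {S : Set E3} {L : E3 ≃ₗᵢ[ℝ] E3} {q : E3} (h : LocallyBarlowAt S L q) (hq : q ∉ S) (ν : E3) :
    ∃ v ∈ S, dist q v < 1 ∧ ⟪q, ν⟫_ℝ ≤ ⟪v, ν⟫_ℝ := by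
  obtain ⟨N, G, t, τ, hτ, hball, -, hSN⟩ := h
  have hqN : q ∈ N := hball (Metric.mem_closedBall_self zero_le_one)
  have hq' : q ∉ stacking G t τ := fun hqG => hq ((Set.ext_iff.1 hSN q).2 ⟨hqG, hqN⟩).1
  obtain ⟨v, hv, hd, hl⟩ := stacking_exists_near_ge hτ G t q ν hq'
  have hvN : v ∈ N := hball (Metric.mem_closedBall.2 (by rw [dist_comm]; exact hd.le))
  exact ⟨v, ((Set.ext_iff.1 hSN v).2 ⟨hv, hvN⟩).1, hd, hl⟩

/-- A near point of `S` at least as high (`ν = e₃`). -/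
theorem exists_near_above_of_locallyBarlowAt {S : Set E3} {L : E3 ≃ₗᵢ[ℝ] E3} {q : E3} (h : LocallyBarlowAt S L q) (hq : q ∉ S) :
    ∃ v ∈ S, dist q v < 1 ∧ q 2 ≤ v 2 := by
  obtain ⟨v, hv, hd, hl⟩ := exists_near_ge_of_locallyBarlowAt h hq (EuclideanSpace.single (2 : Fin 3) (1 : ℝ))
  rw [inner_single_two_one, inner_single_two_one] at hl
  exact ⟨v, hv, hd, hl⟩

/-- A near point of `S` at most as high (`ν = −e₃`). -/
theorem exists_near_below_of_locallyBarlowAt {S : Set E3} {L : E3 ≃ₗᵢ[ℝ] E3} {q : E3} (h : LocallyBarlowAt S L q) (hq : q ∉ S) :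
    ∃ v ∈ S, dist q v < 1 ∧ v 2 ≤ q 2 := by
  obtain ⟨v, hv, hd, hl⟩ := exists_near_ge_of_locallyBarlowAt h hq (-EuclideanSpace.single (2 : Fin 3) (1 : ℝ))
  rw [inner_neg_right, inner_neg_right, inner_single_two_one, inner_single_two_one] at hl
  exact ⟨v, hv, hd, by linarith⟩

/-! ## (S′) Sealing of a clamped pieced plate at regular points -/

/-- **Pieced sealing below (bottom plate).**  `X` unit-separated, `P ⊆ X` the complete clamp sample of the pieced stacking `S`
(`P = {p ∈ S, a ≤ p₂ ≤ b, p₀² + p₁² ≤ ρ²}`, `ρ ≥ 1`); then no `q ∈ X ∖ P` at which `S` is locally Barlow has `a ≤ q₂ ≤ b − 1` and `q₀² + q₁² ≤ (ρ−1)²`. -/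
theorem pieced_sealing_below {S : Set E3} {L : E3 ≃ₗᵢ[ℝ] E3} (a b ρ : ℝ) (hρ : 1 ≤ ρ) (X P : Finset E3)
    (hX : ∀ p ∈ X, ∀ q ∈ X, p ≠ q → 1 ≤ dist p q) (hPX : P ⊆ X)
    (hP : ∀ p, p ∈ P ↔ (p ∈ S ∧ a ≤ p 2 ∧ p 2 ≤ b ∧ p 0 ^ 2 + p 1 ^ 2 ≤ ρ ^ 2))
    (q : E3) (hqX : q ∈ X) (hqP : q ∉ P) (hreg : LocallyBarlowAt S L q)
    (ha : a ≤ q 2) (hb : q 2 ≤ b - 1) (hr : q 0 ^ 2 + q 1 ^ 2 ≤ (ρ - 1) ^ 2) : False := by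
  have hρ' : (ρ - 1) ^ 2 ≤ ρ ^ 2 := by nlinarith
  by_cases hqS : q ∈ S
  · exact hqP ((hP q).2 ⟨hqS, ha, by linarith, hr.trans hρ'⟩)
  obtain ⟨v, hvS, hd, hz⟩ := exists_near_above_of_locallyBarlowAt hreg hqS
  rw [dist_comm] at hd
  have hsq := dist_sq_eq_three v q
  have hd2 : dist v q ^ 2 < 1 := by
    have := pow_lt_pow_left₀ hd dist_nonneg two_ne_zero
    simpa using this
  have hz' : v 2 < q 2 + 1 := by nlinarith [sq_nonneg (v 0 - q 0), sq_nonneg (v 1 - q 1)]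
  have hlat : v 0 ^ 2 + v 1 ^ 2 ≤ ρ ^ 2 := by
    have := lateral_sq_le_of_dist_le_one (y := v) (q := q) (r := ρ - 1) (by linarith) hr hd.le
    simpa using this
  have hvP : v ∈ P := (hP v).2 ⟨hvS, by linarith, by linarith, hlat⟩
  have hne : v ≠ q := fun h => hqS (h ▸ hvS)
  have := hX v (hPX hvP) q hqX hne
  linarith

/-- **Pieced sealing above (top plate).**  Same setting; no `q ∈ X ∖ P` at which `S` is locally Barlow has `a + 1 ≤ q₂ ≤ b` and
`q₀² + q₁² ≤ (ρ−1)²`. -/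
theorem pieced_sealing_above {S : Set E3} {L : E3 ≃ₗᵢ[ℝ] E3} (a b ρ : ℝ) (hρ : 1 ≤ ρ) (X P : Finset E3)
    (hX : ∀ p ∈ X, ∀ q ∈ X, p ≠ q → 1 ≤ dist p q) (hPX : P ⊆ X)
    (hP : ∀ p, p ∈ P ↔ (p ∈ S ∧ a ≤ p 2 ∧ p 2 ≤ b ∧ p 0 ^ 2 + p 1 ^ 2 ≤ ρ ^ 2))
    (q : E3) (hqX : q ∈ X) (hqP : q ∉ P) (hreg : LocallyBarlowAt S L q)
    (ha : a + 1 ≤ q 2) (hb : q 2 ≤ b) (hr : q 0 ^ 2 + q 1 ^ 2 ≤ (ρ - 1) ^ 2) : False := by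
  have hρ' : (ρ - 1) ^ 2 ≤ ρ ^ 2 := by nlinarith
  by_cases hqS : q ∈ S
  · exact hqP ((hP q).2 ⟨hqS, by linarith, hb, hr.trans hρ'⟩)
  obtain ⟨v, hvS, hd, hz⟩ := exists_near_below_of_locallyBarlowAt hreg hqS
  rw [dist_comm] at hd
  have hsq := dist_sq_eq_three v q
  have hd2 : dist v q ^ 2 < 1 := by
    have := pow_lt_pow_left₀ hd dist_nonneg two_ne_zero
    simpa using this
  have hz' : q 2 - 1 < v 2 := by nlinarith [sq_nonneg (v 0 - q 0), sq_nonneg (v 1 - q 1)]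
  have hlat : v 0 ^ 2 + v 1 ^ 2 ≤ ρ ^ 2 := by
    have := lateral_sq_le_of_dist_le_one (y := v) (q := q) (r := ρ - 1) (by linarith) hr hd.le
    simpa using this
  have hvP : v ∈ P := (hP v).2 ⟨hvS, by linarith, by linarith, hlat⟩
  have hne : v ≠ q := fun h => hqS (h ▸ hvS)
  have := hX v (hPX hvP) q hqX hne
  linarith

/-! ## (F′) Frame identification deep in a clamped pieced plate -/

/-- **Star rigidity at a regular point of a locally-Barlow set**: `S` locally Barlow at `y ∈ S` (frame of the same lattice as `L`), `F` a frame with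
three independent slots `a, b, c` such that `y + F a, y + F b, y + F c ∈ S`: then `F·Λ₀ = L·Λ₀` or `F·Λ₀ = (twinFrame G (G e₃))·Λ₀` for some frame
`G` with `G·Λ₀ = L·Λ₀` (the twin across the LOCAL basal plane: basal twin in a territory, inclined twin at a clean seam). -/
theorem frame_eq_or_eq_twin_of_locallyBarlowAt {S : Set E3} {L : E3 ≃ₗᵢ[ℝ] E3} {y : E3} (hreg : LocallyBarlowAt S L y) (hy : y ∈ S)
    (F : E3 ≃ₗᵢ[ℝ] E3) {a b c : E3} (ha : a ∈ fccSlots) (hb : b ∈ fccSlots) (hc : c ∈ fccSlots)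
    (hind : LinearIndependent ℝ ![a, b, c]) (haS : y + F a ∈ S) (hbS : y + F b ∈ S) (hcS : y + F c ∈ S) :
    F '' fccStacking 1 (Real.sqrt (2 / 3)) = L '' fccStacking 1 (Real.sqrt (2 / 3)) ∨
      ∃ G : E3 ≃ₗᵢ[ℝ] E3, G '' fccStacking 1 (Real.sqrt (2 / 3)) = L '' fccStacking 1 (Real.sqrt (2 / 3)) ∧
        F '' fccStacking 1 (Real.sqrt (2 / 3)) =
          (twinFrame G (G (EuclideanSpace.single (2 : Fin 3) (1 : ℝ)))) '' fccStacking 1 (Real.sqrt (2 / 3)) := by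
  obtain ⟨N, G, t, τ, hτ, hball, hGL, hSN⟩ := hreg
  -- everything within the closed unit ball of `y` that lies in `S` lies in the local stacking
  have hloc : ∀ {p : E3}, p ∈ S → dist p y ≤ 1 → p ∈ stacking G t τ := fun {p} hp hd =>
    ((Set.ext_iff.1 hSN p).1 ⟨hp, hball (Metric.mem_closedBall.2 hd)⟩).1
  have hnb : ∀ {w : E3}, w ∈ fccSlots → y + F w ∈ S → y + F w ∈ stacking G t τ := by
    intro w hw hwS
    refine hloc hwS ?_
    rw [dist_eq_norm, add_sub_cancel_left, LinearIsometryEquiv.norm_map, norm_eq_one_of_mem_fccSlots hw]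
  have hyG : y ∈ stacking G t τ := hloc hy (by rw [dist_self]; exact zero_le_one)
  rcases barlow_frame_eq_or_eq_twin hτ G t F hyG ha hb hc hind (hnb ha haS) (hnb hb hbS) (hnb hc hcS) with h | h
  · exact Or.inl (h.trans hGL)
  · exact Or.inr ⟨G, hGL, h⟩

/-- **(F′) LOW: deep in a clamped pieced bottom plate, the frame is the plate's lattice or a twin of it across a local basal plane.**
`X` unit-separated, `P₁ = {p ∈ S, −2R₀ ≤ p₂ ≤ −R₀, p₀² + p₁² ≤ ρ²} ⊆ X` (`ρ ≥ 2`), no ball below `−2R₀`; `y ∈ X` at height `≤ −R₀ − 2`, off the rim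
(`y₀² + y₁² ≤ (ρ−2)²`), `S` locally Barlow at every ball of `X` within `1` of `y`; three independent exact `F`-slots at `y` in `X`. -/
theorem pieced_frame_of_exact_neighbours_low {S : Set E3} {L₁ : E3 ≃ₗᵢ[ℝ] E3}
    (X P₁ : Finset E3) (R₀ ρ : ℝ) (hρ2 : 2 ≤ ρ)
    (hX : ∀ p ∈ X, ∀ q ∈ X, p ≠ q → 1 ≤ dist p q) (hP₁X : P₁ ⊆ X)
    (hcell : ∀ p ∈ X, -(2 * R₀) ≤ p 2)
    (hP₁ : ∀ p, p ∈ P₁ ↔ (p ∈ S ∧ -(2 * R₀) ≤ p 2 ∧ p 2 ≤ -R₀ ∧ p 0 ^ 2 + p 1 ^ 2 ≤ ρ ^ 2))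
    (F : E3 ≃ₗᵢ[ℝ] E3) {y : E3} (hy : y ∈ X) (hy2 : y 2 ≤ -R₀ - 2) (hyr : y 0 ^ 2 + y 1 ^ 2 ≤ (ρ - 2) ^ 2)
    (hreg : ∀ q ∈ X, dist q y ≤ 1 → LocallyBarlowAt S L₁ q)
    {a b c : E3} (ha : a ∈ fccSlots) (hb : b ∈ fccSlots) (hc : c ∈ fccSlots) (hind : LinearIndependent ℝ ![a, b, c])
    (haX : y + F a ∈ X) (hbX : y + F b ∈ X) (hcX : y + F c ∈ X) :
    F '' fccStacking 1 (Real.sqrt (2 / 3)) = L₁ '' fccStacking 1 (Real.sqrt (2 / 3)) ∨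
      ∃ G : E3 ≃ₗᵢ[ℝ] E3, G '' fccStacking 1 (Real.sqrt (2 / 3)) = L₁ '' fccStacking 1 (Real.sqrt (2 / 3)) ∧
        F '' fccStacking 1 (Real.sqrt (2 / 3)) =
          (twinFrame G (G (EuclideanSpace.single (2 : Fin 3) (1 : ℝ)))) '' fccStacking 1 (Real.sqrt (2 / 3)) := by
  have hρ2' : (0 : ℝ) ≤ ρ - 2 := by linarith
  -- sealing at the regular balls near `y`
  have hseal : ∀ q ∈ X, dist q y ≤ 1 → q 2 ≤ -R₀ - 1 → q 0 ^ 2 + q 1 ^ 2 ≤ (ρ - 1) ^ 2 → q ∈ S := by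
    intro q hq hqy hq2 hqr
    by_cases hqP : q ∈ P₁
    · exact ((hP₁ q).1 hqP).1
    · exact (pieced_sealing_below (-(2 * R₀)) (-R₀) ρ (by linarith) X P₁ hX hP₁X hP₁ q hq hqP (hreg q hq hqy)
        (hcell q hq) (by linarith) hqr).elim
  have hyS : y ∈ S := hseal y hy (by rw [dist_self]; exact zero_le_one) (by linarith) (hyr.trans (by nlinarith))
  have nbS : ∀ {w : E3}, w ∈ fccSlots → y + F w ∈ X → y + F w ∈ S := by
    intro w hw hwX
    have hn1 : ‖F w‖ = 1 := by rw [LinearIsometryEquiv.norm_map, norm_eq_one_of_mem_fccSlots hw]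
    have hdy : dist (y + F w) y ≤ 1 := by rw [dist_eq_norm, add_sub_cancel_left, hn1]
    apply hseal _ hwX hdy
    · have h1 := abs_apply_sub_le_dist (y + F w) y 2
      rw [dist_eq_norm, add_sub_cancel_left, hn1] at h1
      have := (abs_le.1 h1).2
      linarith
    · have := lateral_sq_add_le y (F w) hρ2' hyr
      rw [hn1] at this
      convert this using 2; ring
  exact frame_eq_or_eq_twin_of_locallyBarlowAt (hreg y hy (by rw [dist_self]; exact zero_le_one)) hyS F ha hb hc hind
    (nbS ha haX) (nbS hb hbX) (nbS hc hcX)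

/-- **(F′) HIGH: deep in a clamped pieced top plate, the frame is the plate's lattice or a twin of it across a local basal plane.** -/
theorem pieced_frame_of_exact_neighbours_high {S : Set E3} {L₂ : E3 ≃ₗᵢ[ℝ] E3}
    (X P₂ : Finset E3) (R₀ h ρ : ℝ) (hρ2 : 2 ≤ ρ)
    (hX : ∀ p ∈ X, ∀ q ∈ X, p ≠ q → 1 ≤ dist p q) (hP₂X : P₂ ⊆ X)
    (hcell : ∀ p ∈ X, p 2 ≤ h + 2 * R₀)
    (hP₂ : ∀ p, p ∈ P₂ ↔ (p ∈ S ∧ h + R₀ ≤ p 2 ∧ p 2 ≤ h + 2 * R₀ ∧ p 0 ^ 2 + p 1 ^ 2 ≤ ρ ^ 2))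
    (F : E3 ≃ₗᵢ[ℝ] E3) {y : E3} (hy : y ∈ X) (hy2 : h + R₀ + 2 ≤ y 2) (hyr : y 0 ^ 2 + y 1 ^ 2 ≤ (ρ - 2) ^ 2)
    (hreg : ∀ q ∈ X, dist q y ≤ 1 → LocallyBarlowAt S L₂ q)
    {a b c : E3} (ha : a ∈ fccSlots) (hb : b ∈ fccSlots) (hc : c ∈ fccSlots) (hind : LinearIndependent ℝ ![a, b, c])
    (haX : y + F a ∈ X) (hbX : y + F b ∈ X) (hcX : y + F c ∈ X) :
    F '' fccStacking 1 (Real.sqrt (2 / 3)) = L₂ '' fccStacking 1 (Real.sqrt (2 / 3)) ∨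
      ∃ G : E3 ≃ₗᵢ[ℝ] E3, G '' fccStacking 1 (Real.sqrt (2 / 3)) = L₂ '' fccStacking 1 (Real.sqrt (2 / 3)) ∧
        F '' fccStacking 1 (Real.sqrt (2 / 3)) =
          (twinFrame G (G (EuclideanSpace.single (2 : Fin 3) (1 : ℝ)))) '' fccStacking 1 (Real.sqrt (2 / 3)) := by
  have hρ2' : (0 : ℝ) ≤ ρ - 2 := by linarith
  have hseal : ∀ q ∈ X, dist q y ≤ 1 → h + R₀ + 1 ≤ q 2 → q 0 ^ 2 + q 1 ^ 2 ≤ (ρ - 1) ^ 2 → q ∈ S := by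
    intro q hq hqy hq2 hqr
    by_cases hqP : q ∈ P₂
    · exact ((hP₂ q).1 hqP).1
    · exact (pieced_sealing_above (h + R₀) (h + 2 * R₀) ρ (by linarith) X P₂ hX hP₂X hP₂ q hq hqP (hreg q hq hqy)
        (by linarith) (hcell q hq) hqr).elim
  have hyS : y ∈ S := hseal y hy (by rw [dist_self]; exact zero_le_one) (by linarith) (hyr.trans (by nlinarith))
  have nbS : ∀ {w : E3}, w ∈ fccSlots → y + F w ∈ X → y + F w ∈ S := by
    intro w hw hwX
    have hn1 : ‖F w‖ = 1 := by rw [LinearIsometryEquiv.norm_map, norm_eq_one_of_mem_fccSlots hw]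
    have hdy : dist (y + F w) y ≤ 1 := by rw [dist_eq_norm, add_sub_cancel_left, hn1]
    apply hseal _ hwX hdy
    · have h1 := abs_apply_sub_le_dist (y + F w) y 2
      rw [dist_eq_norm, add_sub_cancel_left, hn1] at h1
      have := (abs_le.1 h1).1
      linarith
    · have := lateral_sq_add_le y (F w) hρ2' hyr
      rw [hn1] at this
      convert this using 2; ring
  exact frame_eq_or_eq_twin_of_locallyBarlowAt (hreg y hy (by rw [dist_self]; exact zero_le_one)) hyS F ha hb hc hind
    (nbS ha haX) (nbS hb hbX) (nbS hc hcX)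

end Summit.Ventures.Crystal3D.Cruxes.TextureLiminf.TexShadow

end
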